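import Literature.Analysis.FluidPDE.NSLocalAnalyticityRadiusForceFamily
import Literature.Analysis.FluidPDE.NSLocalAnalyticityRadiusDuality
import HarnessLib

/-!
# The Duhamel forcing term of the localised system: regularity, solenoidality, pairing, and
# vanishing at infinity under the heat flow

Analysis/FluidPDE proofs-layer file (theorems only), module L3c of the proof of the named fact
`Literature.Analysis.FluidPDE.bradshawGrujicKukavica2015_local_analyticity_radius`
(Bradshaw–Grujić–Kukavica 2015, Thm. 2.3, §4). For a classical solution `(u, p)` on the open
cylinder `(-δ, R²) × B(x₁, R)` and an admissible cut-off `χ`, the forcing term of the Oseen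
representation of the localised field,

  `F(t) = locForcing χ u p s₀ t = ∫_{(s₀,t)} e^{(t-s)Δ} P[f₀(s)] ds`

(`P[f₀(s)] = locProjForce`, `NSLocalAnalyticityRadiusLocalisation.lean`), is studied for
`-δ < s₀ ≤ t ≤ t₁ < R²`:

* the heat flows `(s, σ, x) ↦ e^{σΔ}P[f₀(s)](x)` form a jointly continuous family over
  `[s₀, t₁]` (`continuousOn_heatFlow_locProjForce`, `continuousOn_heatFlow_locProjForce_sub`);
* `norm_locForcing_le` — `‖F(t, x)‖ ≤ C (t - s₀)`; `continuous_locForcing` (in `x`);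
* `isWeaklyDivFree_locForcing` — `F(t)` is weakly divergence free (each `e^{σΔ}P[f₀(s)]` is);
* `integral_inner_locForcing_eq` — **the duality pairing**: for a smooth compactly supported
  divergence-free `φ`, `∫ ⟪F(t), φ⟫ = ∫_{(s₀,t)} ∫ ⟪f₀(s), e^{(t-s)Δ}φ⟫ ds` (Fubini, symmetry of
  the heat semigroup, and the self-adjointness of the Leray projection against solenoidal caloric
  tests, `integral_inner_classicalLerayProj_heatFlow`);
* `heatExtension_locForcing_apply` and `norm_heatExtension_locForcing_le` — **vanishing at
  infinity under the heat flow**: `e^{θΔ}F(t) = ∫ e^{(θ+t-s)Δ}P[f₀(s)] ds` and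
  `‖e^{θΔ}F(t)(x)‖ ≤ C' (t - s₀) θ^{-1/2}` for `θ ≥ 1` (`e^{σΔ}P[f₀] = e^{σΔ}f₀ - ∇e^{σΔ}π[f₀]`
  with `‖e^{σΔ}f₀‖_∞ ≲ σ^{-3/2}‖f₀‖₁` and `‖∇e^{σΔ}π‖_∞ ≲ σ^{-1/2}‖π‖_∞`), the Oseen condition
  "`lim_{θ→∞} e^{θΔ}(·) = 0`" of Lemarié-Rieusset 2016, Def. 6.5 / Thm. 6.1 for this term.

## Mathlib / tree search

Tree: `heatFlow`, `heatFlow_of_pos/of_nonpos`, `norm_heatFlow_le`, `integrable_heatFlow`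
(`MildSolution(Proofs)`); `continuous_integral_heatKernel_one_smul_param`
(`KatoUniquenessDual`), `heatExtension_eq_integral_heatKernel_one`,
`integral_heatKernel_one_smul_of_nonpos`, `norm_heatExtension_le`, `heatKernel_le`
(`UnboundedOperators`); `heatExtension_sub_of_bound`, `norm_fderiv_heatExtension_le_of_bounded`
(`HeatKernelBoundedData`); `heatExtension_add_holds` (semigroup),
`integral_inner_heatExtension_comm_of_bound`, `IsWeaklyDivFree.heatExtension_of_bound`;
`heatExtension_gradient_divPotential`, `integral_inner_classicalLerayProj_heatFlow`
(`DivPotentialHeatPairing`); module L3b. Mathlib: `integral_prod`, `integral_prod_symm`,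
`Measure.prod_restrict`, `continuous_of_dominated`, `norm_setIntegral_le_of_norm_le_const`.

## References

* Z. Bradshaw, Z. Grujić, I. Kukavica, J. Differential Equations 259 (2015), §4.
  [BradshawGrujicKukavica2015]
* P. G. Lemarié-Rieusset, *The Navier–Stokes Problem in the 21st Century*, CRC Press 2016,
  Def. 6.5, Thm. 6.1 (Oseen solutions: the condition `e^{θΔ}(·) → 0`). [LemarieRieusset2016]
-/

noncomputable section

open MeasureTheory Set Function Filter Metric Real
open _root_.Topology
open scoped ENNReal ContDiff Laplacian InnerProductSpace RealInnerProductSpace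

namespace Literature.Analysis.FluidPDE

/-! ### Heat flows of a jointly continuous bounded family -/

section ParamHeat

variable {F : Type*} [NormedAddCommGroup F] [NormedSpace ℝ F] [CompleteSpace F]

/-- **Joint continuity of `(s, σ, x) ↦ e^{σΔ}G(s)(x)` on `S × ℝ × ℝ³`** (`heatFlow`, the
identity for `σ ≤ 0`) for a family of data `G : ℝ → ℝ³ → F` jointly continuous on `S × ℝ³` and
uniformly bounded there: the flow agrees for every real `σ` with the scaled caloric integral
`∫ G_1(z) • G(s)(x - √σ z) dz`, which is jointly continuous by dominated convergence with the
fixed majorant `C G_1` (the `ContinuousOn` form of the tree's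
`continuous_integral_heatKernel_one_smul_param`). [folklore] -/
theorem continuousOn_heatFlow_param {G : ℝ → EuclideanSpace ℝ (Fin 3) → F} {S : Set ℝ}
    (hG : ContinuousOn (uncurry G) (S ×ˢ univ)) {C : ℝ} (hC : ∀ s ∈ S, ∀ z, ‖G s z‖ ≤ C) :
    ContinuousOn (fun q : ℝ × ℝ × EuclideanSpace ℝ (Fin 3) => heatFlow (G q.1) q.2.1 q.2.2)
      (S ×ˢ univ) := by
  have hK := UnboundedOperators.continuous_heatKernel (E := EuclideanSpace ℝ (Fin 3)) 1
  have hK0 : ∀ z, 0 ≤ UnboundedOperators.heatKernel (E := EuclideanSpace ℝ (Fin 3)) 1 z := fun z =>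
    (UnboundedOperators.heatKernel_pos one_pos z).le
  -- the scaled caloric integral is continuous on `S × ℝ × ℝ³`
  have hint : ContinuousOn (fun q : ℝ × ℝ × EuclideanSpace ℝ (Fin 3) =>
      ∫ z, UnboundedOperators.heatKernel 1 z • G q.1 (q.2.2 - Real.sqrt q.2.1 • z)) (S ×ˢ univ) := by
    refine continuousOn_of_dominated (bound := fun z => UnboundedOperators.heatKernel 1 z * C)
      ?_ ?_ ?_ ?_
    · intro q hq
      have hq1 : q.1 ∈ S := (mem_prod.1 hq).1
      have hs : Continuous (G q.1) :=
        hG.comp_continuous (Continuous.prodMk_right q.1) fun y => mk_mem_prod hq1 (mem_univ y)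
      have hm : Continuous fun z : EuclideanSpace ℝ (Fin 3) => q.2.2 - Real.sqrt q.2.1 • z :=
        continuous_const.sub (continuous_id.const_smul (Real.sqrt q.2.1))
      exact (hK.smul (hs.comp hm)).aestronglyMeasurable
    · intro q hq
      have hq1 : q.1 ∈ S := (mem_prod.1 hq).1
      refine Eventually.of_forall fun z => ?_
      rw [norm_smul, Real.norm_of_nonneg (hK0 z)]
      exact mul_le_mul_of_nonneg_left (hC _ hq1 _) (hK0 z)
    · exact (UnboundedOperators.integrable_heatKernel_holds one_pos).mul_const C
    · refine Eventually.of_forall fun z => ?_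
      have hmap : Continuous fun q : ℝ × ℝ × EuclideanSpace ℝ (Fin 3) =>
          ((q.1, q.2.2 - Real.sqrt q.2.1 • z) : ℝ × EuclideanSpace ℝ (Fin 3)) :=
        continuous_fst.prodMk ((continuous_snd.comp continuous_snd).sub
          ((Real.continuous_sqrt.comp (continuous_fst.comp continuous_snd)).smul continuous_const))
      have h := hG.comp (hmap.continuousOn (s := S ×ˢ (univ : Set (ℝ × EuclideanSpace ℝ (Fin 3)))))
        (fun q hq => ⟨(mem_prod.1 hq).1, mem_univ _⟩)
      exact (continuousOn_const.smul h).congr fun q _ => rfl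
  refine hint.congr fun q _ => ?_
  show heatFlow (G q.1) q.2.1 q.2.2 =
    ∫ z, UnboundedOperators.heatKernel 1 z • G q.1 (q.2.2 - Real.sqrt q.2.1 • z)
  rcases le_or_gt q.2.1 0 with hσ | hσ
  · rw [heatFlow_of_nonpos _ hσ, UnboundedOperators.integral_heatKernel_one_smul_of_nonpos hσ]
  · rw [heatFlow_of_pos _ hσ, UnboundedOperators.heatExtension_eq_integral_heatKernel_one hσ]

end ParamHeat

namespace BGK2015

variable {x₁ : EuclideanSpace ℝ (Fin 3)} {δ R : ℝ}
  {u : ℝ → EuclideanSpace ℝ (Fin 3) → EuclideanSpace ℝ (Fin 3)}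
  {p : ℝ → EuclideanSpace ℝ (Fin 3) → ℝ} {χ : EuclideanSpace ℝ (Fin 3) → ℝ}

/-! ### The heat flows of the projected force family -/

section Flows

variable (hsol : IsCylinderSolution x₁ δ R u p) (hχ : IsLocCutoff x₁ R χ) {s₀ t₁ : ℝ}
  (hI : Icc s₀ t₁ ⊆ Ioo (-δ) (R ^ 2))
include hsol hχ hI

/-- **The heat flows of the projected force are jointly continuous**:
`(s, σ, x) ↦ e^{σΔ}P[f₀(s)](x)` is continuous on `[s₀, t₁] × ℝ × ℝ³`. [folklore] -/
theorem continuousOn_heatFlow_locProjForce :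
    ContinuousOn (fun q : ℝ × ℝ × EuclideanSpace ℝ (Fin 3) =>
      heatFlow (locProjForce χ u p q.1) q.2.1 q.2.2) (Icc s₀ t₁ ×ˢ univ) := by
  obtain ⟨C, -, hC⟩ := exists_forall_norm_locProjForce_le hsol hχ hI
  exact continuousOn_heatFlow_param
    ((continuousOn_uncurry_locProjForce hsol hχ).mono (prod_mono hI subset_rfl)) hC

/-- For a fixed final time `t`, `(s, x) ↦ e^{(t-s)Δ}P[f₀(s)](x)` is jointly continuous on
`[s₀, t₁] × ℝ³`. [folklore] -/
theorem continuousOn_heatFlow_locProjForce_sub (t : ℝ) :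
    ContinuousOn (uncurry fun s x => heatFlow (locProjForce χ u p s) (t - s) x) (Icc s₀ t₁ ×ˢ univ) := by
  have h := continuousOn_heatFlow_locProjForce hsol hχ hI
  have hmap : Continuous fun z : ℝ × EuclideanSpace ℝ (Fin 3) =>
      ((z.1, t - z.1, z.2) : ℝ × ℝ × EuclideanSpace ℝ (Fin 3)) :=
    continuous_fst.prodMk ((continuous_const.sub continuous_fst).prodMk continuous_snd)
  exact (h.comp hmap.continuousOn fun z hz => ⟨(mem_prod.1 hz).1, mem_univ _⟩).congr
    fun z _ => rfl

/-- The heat flows of the projected force are uniformly bounded: `‖e^{σΔ}P[f₀(s)](x)‖ ≤ C` for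
`s ∈ [s₀, t₁]` and all `σ`, `x`. [folklore] -/
theorem exists_forall_norm_heatFlow_locProjForce_le :
    ∃ C : ℝ, 0 ≤ C ∧ ∀ s ∈ Icc s₀ t₁, ∀ σ x, ‖heatFlow (locProjForce χ u p s) σ x‖ ≤ C := by
  obtain ⟨C, hC0, hC⟩ := exists_forall_norm_locProjForce_le hsol hχ hI
  exact ⟨C, hC0, fun s hs σ x => norm_heatFlow_le (hC s hs) σ x⟩

end Flows

/-! ### The forcing term: bound, continuity, solenoidality, pairing -/

section Forcing

variable (hsol : IsCylinderSolution x₁ δ R u p) (hχ : IsLocCutoff x₁ R χ) {s₀ t₁ : ℝ}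
  (hI : Icc s₀ t₁ ⊆ Ioo (-δ) (R ^ 2))
include hsol hχ hI

/-- **`‖F(t, x)‖ ≤ C (t - s₀)`** for `t ∈ [s₀, t₁]`. [folklore] -/
theorem exists_norm_locForcing_le :
    ∃ C : ℝ, 0 ≤ C ∧ ∀ t ∈ Icc s₀ t₁, ∀ x, ‖locForcing χ u p s₀ t x‖ ≤ C * (t - s₀) := by
  obtain ⟨C, hC0, hC⟩ := exists_forall_norm_heatFlow_locProjForce_le hsol hχ hI
  refine ⟨C, hC0, fun t ht x => ?_⟩
  rw [locForcing_apply]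
  have h := norm_setIntegral_le_of_norm_le_const (μ := (volume : Measure ℝ)) (s := Ioo s₀ t)
    (f := fun s => heatFlow (locProjForce χ u p s) (t - s) x) measure_Ioo_lt_top
    fun s hs => hC s ⟨hs.1.le, hs.2.le.trans ht.2⟩ _ _
  rwa [Measure.real, Real.volume_Ioo, ENNReal.toReal_ofReal (by linarith [ht.1])] at h

/-- The integrand of the forcing term is continuous in `s` on `[s₀, t₁]` at every `x`. [folklore] -/
theorem continuousOn_heatFlow_locProjForce_line (t : ℝ) (x : EuclideanSpace ℝ (Fin 3)) :
    ContinuousOn (fun s => heatFlow (locProjForce χ u p s) (t - s) x) (Icc s₀ t₁) :=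
  (continuousOn_heatFlow_locProjForce_sub hsol hχ hI t).comp
    (continuous_id.prodMk continuous_const).continuousOn fun _ hs => ⟨hs, mem_univ _⟩

/-- The integrand of the forcing term is integrable on `(s₀, t)`, `t ≤ t₁`. [folklore] -/
theorem integrableOn_heatFlow_locProjForce_line {t : ℝ} (ht : t ∈ Icc s₀ t₁)
    (x : EuclideanSpace ℝ (Fin 3)) :
    IntegrableOn (fun s => heatFlow (locProjForce χ u p s) (t - s) x) (Ioo s₀ t) :=
  ((continuousOn_heatFlow_locProjForce_line hsol hχ hI t x).mono
    (Icc_subset_Icc_right ht.2)).integrableOn_Icc.mono_set Ioo_subset_Icc_self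

/-- **`F(t)` is continuous in `x`** (dominated convergence). [folklore] -/
theorem continuous_locForcing {t : ℝ} (ht : t ∈ Icc s₀ t₁) : Continuous (locForcing χ u p s₀ t) := by
  obtain ⟨C, -, hC⟩ := exists_forall_norm_heatFlow_locProjForce_le hsol hχ hI
  have hjoint := continuousOn_heatFlow_locProjForce_sub hsol hχ hI t
  have hF : locForcing χ u p s₀ t = fun x => ∫ s in Ioo s₀ t, heatFlow (locProjForce χ u p s) (t - s) x :=
    rfl
  rw [hF]
  refine continuous_of_dominated (bound := fun _ => C) ?_ ?_ ?_ ?_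
  · intro x
    exact ((continuousOn_heatFlow_locProjForce_line hsol hχ hI t x).mono
      (Ioo_subset_Icc_self.trans (Icc_subset_Icc_right ht.2))).aestronglyMeasurable measurableSet_Ioo
  · intro x
    rw [ae_restrict_iff' measurableSet_Ioo]
    exact Eventually.of_forall fun s hs => hC s ⟨hs.1.le, hs.2.le.trans ht.2⟩ _ _
  · exact integrableOn_const measure_Ioo_lt_top.ne
  · rw [ae_restrict_iff' measurableSet_Ioo]
    refine Eventually.of_forall fun s hs => ?_
    exact hjoint.comp_continuous (Continuous.prodMk_right s) fun x => ⟨⟨hs.1.le, hs.2.le.trans ht.2⟩, mem_univ _⟩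

/-- **The pairing of `F(t)` with a compactly supported continuous field is the time integral of
the pairings** (the inner product through the Bochner integral in `s`, then Fubini over the
compact spatial support). [folklore] -/
theorem integral_inner_locForcing_eq_setIntegral {t : ℝ} (ht : t ∈ Icc s₀ t₁)
    {ψ : EuclideanSpace ℝ (Fin 3) → EuclideanSpace ℝ (Fin 3)} (hψ : Continuous ψ)
    (hψc : HasCompactSupport ψ) :
    ∫ x, ⟪locForcing χ u p s₀ t x, ψ x⟫ =
      ∫ s in Ioo s₀ t, ∫ x, ⟪heatFlow (locProjForce χ u p s) (t - s) x, ψ x⟫ := by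
  obtain ⟨K, hK, hK0⟩ : ∃ K : Set (EuclideanSpace ℝ (Fin 3)), IsCompact K ∧ ∀ x ∉ K, ψ x = 0 :=
    ⟨tsupport ψ, hψc, fun x hx => image_eq_zero_of_notMem_tsupport hx⟩
  -- inner product through the `s`-integral
  have e1 : ∀ x, ⟪locForcing χ u p s₀ t x, ψ x⟫ =
      ∫ s in Ioo s₀ t, ⟪heatFlow (locProjForce χ u p s) (t - s) x, ψ x⟫ := by
    intro x
    rw [locForcing_apply, real_inner_comm,
      ← integral_inner (integrableOn_heatFlow_locProjForce_line hsol hχ hI ht x) (ψ x)]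
    exact integral_congr_ae (Eventually.of_forall fun s => real_inner_comm _ _)
  simp_rw [e1]
  -- Fubini: the integrand is jointly continuous on `[s₀, t] × ℝ³` and supported in `K`
  have hkc : ContinuousOn (uncurry fun s x => ⟪heatFlow (locProjForce χ u p s) (t - s) x, ψ x⟫)
      (Icc s₀ t₁ ×ˢ univ) :=
    (continuousOn_heatFlow_locProjForce_sub hsol hχ hI t).inner (hψ.comp continuous_snd).continuousOn
  have hswap := integral_setIntegral_swap_of_continuousOn (S := Icc s₀ t₁) ht.1
    (Icc_subset_Icc_right ht.2) hK hkc (fun _ x hx => by simp [hK0 x hx])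
  calc ∫ x, ∫ s in Ioo s₀ t, ⟪heatFlow (locProjForce χ u p s) (t - s) x, ψ x⟫
      = ∫ x, ∫ s in Ioc s₀ t, ⟪heatFlow (locProjForce χ u p s) (t - s) x, ψ x⟫ :=
        integral_congr_ae (Eventually.of_forall fun x => setIntegral_congr_set Ioo_ae_eq_Ioc)
    _ = ∫ s in Ioc s₀ t, ∫ x, ⟪heatFlow (locProjForce χ u p s) (t - s) x, ψ x⟫ := hswap
    _ = ∫ s in Ioo s₀ t, ∫ x, ⟪heatFlow (locProjForce χ u p s) (t - s) x, ψ x⟫ :=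
        (setIntegral_congr_set Ioo_ae_eq_Ioc).symm

/-- **`F(t)` is weakly divergence free.** [folklore] -/
theorem isWeaklyDivFree_locForcing {t : ℝ} (ht : t ∈ Icc s₀ t₁) :
    IsWeaklyDivFree (locForcing χ u p s₀ t) := by
  intro θ hθ
  have hθ1 : ContDiff ℝ 1 θ := hθ.contDiff.of_le (by norm_cast)
  have hgc : Continuous (gradient θ) := continuous_gradient_of_contDiff hθ1
  have hgs : HasCompactSupport (gradient θ) :=
    hθ.hasCompactSupport.mono' fun x hx => by
      by_contra h; exact hx (gradient_eq_zero_of_notMem_tsupport h)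
  rw [integral_inner_locForcing_eq_setIntegral hsol hχ hI ht hgc hgs]
  refine setIntegral_eq_zero_of_forall_eq_zero fun s hs => ?_
  have hsI : s ∈ Icc s₀ t₁ := ⟨hs.1.le, hs.2.le.trans ht.2⟩
  have hsS := hI hsI
  have hdiv : IsWeaklyDivFree (locProjForce χ u p s) :=
    VectorCalculus.IsDivFree.isWeaklyDivFree_holds (isDivFree_locProjForce hsol hχ hsS)
      ((contDiff_locProjForce hsol hχ hsS).of_le (by norm_cast))
  have hσ : 0 < t - s := sub_pos.2 hs.2
  obtain ⟨C, -, hC⟩ := exists_forall_norm_locProjForce_le hsol hχ hI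
  rw [heatFlow_of_pos _ hσ]
  exact hdiv.heatExtension_of_bound (contDiff_locProjForce hsol hχ hsS).continuous.aestronglyMeasurable
    (hC s hsI) hσ θ hθ

/-- **The duality pairing of the forcing term**: for `φ` smooth, compactly supported and
divergence free, `∫ ⟪F(t), φ⟫ = ∫_{(s₀,t)} ∫ ⟪f₀(s), e^{(t-s)Δ}φ⟫ ds`. [cite: LemarieRieusset2016, Thm. 6.1 ((6.11)–(6.12))] -/
theorem integral_inner_locForcing_eq {t : ℝ} (ht : t ∈ Icc s₀ t₁)
    {φ : EuclideanSpace ℝ (Fin 3) → EuclideanSpace ℝ (Fin 3)}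
    (hφ : FunctionSpaces.IsTestFunctionOn (⊤ : TopologicalSpace.Opens (EuclideanSpace ℝ (Fin 3))) φ)
    (hdiv : VectorCalculus.IsDivFree φ) :
    ∫ x, ⟪locForcing χ u p s₀ t x, φ x⟫ =
      ∫ s in Ioo s₀ t, ∫ x, ⟪locForce χ u p s x, heatTest 1 φ (t - s) x⟫ := by
  rw [integral_inner_locForcing_eq_setIntegral hsol hχ hI ht hφ.contDiff.continuous
    hφ.hasCompactSupport]
  refine setIntegral_congr_fun measurableSet_Ioo fun s hs => ?_
  have hsI : s ∈ Icc s₀ t₁ := ⟨hs.1.le, hs.2.le.trans ht.2⟩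
  have hsS := hI hsI
  have hσ : 0 < t - s := sub_pos.2 hs.2
  obtain ⟨C, -, hC⟩ := exists_forall_norm_locProjForce_le hsol hχ hI
  show ∫ x, ⟪heatFlow (locProjForce χ u p s) (t - s) x, φ x⟫ =
    ∫ x, ⟪locForce χ u p s x, heatTest 1 φ (t - s) x⟫
  rw [heatFlow_of_pos _ hσ, integral_inner_heatExtension_comm_of_bound
    (contDiff_locProjForce hsol hχ hsS).continuous.aestronglyMeasurable (hC s hsI)
    hφ.contDiff.continuous hφ.hasCompactSupport hσ]
  have e : ∀ x, UnboundedOperators.heatExtension φ (t - s) x = heatFlow φ (t - s) x := fun x => by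
    rw [heatFlow_of_pos _ hσ]
  simp_rw [e, locProjForce_eq]
  rw [integral_inner_classicalLerayProj_heatFlow (contDiff_locForce hsol hχ hsS)
    (hasCompactSupport_locForce hχ) hφ hdiv]
  simp [heatTest, one_mul]

end Forcing

/-! ### Vanishing at infinity under the heat flow -/

section HeatFlowAtInfinity

variable (hsol : IsCylinderSolution x₁ δ R u p) (hχ : IsLocCutoff x₁ R χ) {s₀ t₁ : ℝ}
  (hI : Icc s₀ t₁ ⊆ Ioo (-δ) (R ^ 2))
include hsol hχ hI

/-- **The heat flow passes inside the Duhamel integral**: for `t ∈ [s₀, t₁]`, `θ > 0`,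
`e^{θΔ}F(t)(x) = ∫_{(s₀,t)} e^{(t-s+θ)Δ}P[f₀(s)](x) ds` (Fubini with the majorant `C G_θ`, then the
semigroup law on the bounded data `P[f₀(s)]`). [folklore] -/
theorem heatExtension_locForcing_apply {t : ℝ} (ht : t ∈ Icc s₀ t₁) {θ : ℝ} (hθ : 0 < θ)
    (x : EuclideanSpace ℝ (Fin 3)) :
    UnboundedOperators.heatExtension (locForcing χ u p s₀ t) θ x =
      ∫ s in Ioo s₀ t, UnboundedOperators.heatExtension (locProjForce χ u p s) (t - s + θ) x := by
  obtain ⟨C, -, hC⟩ := exists_forall_norm_heatFlow_locProjForce_le hsol hχ hI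
  obtain ⟨C₀, -, hC₀⟩ := exists_forall_norm_locProjForce_le hsol hχ hI
  have hIt : Icc s₀ t ⊆ Icc s₀ t₁ := Icc_subset_Icc_right ht.2
  set μ : Measure ℝ := volume.restrict (Ioo s₀ t) with hμ
  haveI : IsFiniteMeasure μ := by rw [hμ]; exact isFiniteMeasure_restrict.2 measure_Ioo_lt_top.ne
  -- the integrand on `ℝ³ × (s₀, t)`
  set Φ : EuclideanSpace ℝ (Fin 3) × ℝ → EuclideanSpace ℝ (Fin 3) := fun z =>
    UnboundedOperators.heatKernel θ z.1 • heatFlow (locProjForce χ u p z.2) (t - z.2) (x - z.1) with hΦ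
  have hK := UnboundedOperators.continuous_heatKernel (E := EuclideanSpace ℝ (Fin 3)) θ
  have hjoint := continuousOn_heatFlow_locProjForce_sub hsol hχ hI t
  have hΦc : ContinuousOn Φ (univ ×ˢ Icc s₀ t₁) := by
    have hmap : Continuous fun z : EuclideanSpace ℝ (Fin 3) × ℝ =>
        ((z.2, x - z.1) : ℝ × EuclideanSpace ℝ (Fin 3)) :=
      continuous_snd.prodMk (continuous_const.sub continuous_fst)
    have h2 := hjoint.comp (hmap.continuousOn (s := univ ×ˢ Icc s₀ t₁))
      (fun z hz => ⟨(mem_prod.1 hz).2, mem_univ _⟩)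
    exact ((hK.comp continuous_fst).continuousOn.smul h2).congr fun z _ => rfl
  have hmeas : AEStronglyMeasurable Φ ((volume : Measure (EuclideanSpace ℝ (Fin 3))).prod μ) := by
    have h1 : AEStronglyMeasurable Φ (((volume : Measure (EuclideanSpace ℝ (Fin 3))).prod
        (volume : Measure ℝ)).restrict (univ ×ˢ Ioo s₀ t)) :=
      (hΦc.mono (prod_mono subset_rfl (Ioo_subset_Icc_self.trans hIt))).aestronglyMeasurable
        (MeasurableSet.univ.prod measurableSet_Ioo)
    rwa [← Measure.prod_restrict, Measure.restrict_univ] at h1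
  have hbound : Integrable (fun z : EuclideanSpace ℝ (Fin 3) × ℝ =>
      UnboundedOperators.heatKernel θ z.1 * C) ((volume : Measure (EuclideanSpace ℝ (Fin 3))).prod μ) := by
    have hG : Integrable (fun y : EuclideanSpace ℝ (Fin 3) => UnboundedOperators.heatKernel θ y * C)
        (volume : Measure (EuclideanSpace ℝ (Fin 3))) :=
      (UnboundedOperators.integrable_heatKernel_holds hθ).mul_const C
    have h := hG.mul_prod (integrable_const (1 : ℝ) (μ := μ))
    exact h.congr (Eventually.of_forall fun z => by simp)
  have hint : Integrable Φ ((volume : Measure (EuclideanSpace ℝ (Fin 3))).prod μ) := by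
    refine hbound.mono' hmeas ?_
    have : ∀ᵐ z ∂((volume : Measure (EuclideanSpace ℝ (Fin 3))).prod μ), z.2 ∈ Ioo s₀ t := by
      refine (Measure.quasiMeasurePreserving_snd (μ := (volume : Measure (EuclideanSpace ℝ (Fin 3))))
        (ν := μ)).ae ?_
      rw [hμ]
      exact ae_restrict_mem measurableSet_Ioo
    filter_upwards [this] with z hz
    rw [hΦ, norm_smul, Real.norm_of_nonneg (UnboundedOperators.heatKernel_pos hθ z.1).le]
    exact mul_le_mul_of_nonneg_left (hC z.2 ⟨hz.1.le, hz.2.le.trans ht.2⟩ _ _)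
      (UnboundedOperators.heatKernel_pos hθ z.1).le
  -- Fubini
  have e1 : UnboundedOperators.heatExtension (locForcing χ u p s₀ t) θ x = ∫ y, ∫ s, Φ (y, s) ∂μ := by
    rw [UnboundedOperators.heatExtension_apply]
    refine integral_congr_ae (Eventually.of_forall fun y => ?_)
    show UnboundedOperators.heatKernel θ y • locForcing χ u p s₀ t (x - y) = ∫ s, Φ (y, s) ∂μ
    rw [locForcing_apply, ← integral_smul]
  rw [e1, integral_integral_swap hint]
  -- the semigroup law on `(s₀, t)`
  refine setIntegral_congr_fun measurableSet_Ioo fun s hs => ?_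
  have hσ : 0 < t - s := sub_pos.2 hs.2
  have hsI : s ∈ Icc s₀ t₁ := ⟨hs.1.le, hs.2.le.trans ht.2⟩
  have hmem : MemLp (locProjForce χ u p s) ∞ (volume : Measure (EuclideanSpace ℝ (Fin 3))) :=
    memLp_top_of_bound (contDiff_locProjForce hsol hχ (hI hsI)).continuous.aestronglyMeasurable _
      (Eventually.of_forall (hC₀ s hsI))
  show ∫ y, Φ (y, s) = UnboundedOperators.heatExtension (locProjForce χ u p s) (t - s + θ) x
  rw [← UnboundedOperators.heatExtension_add_holds hmem le_top hσ hθ,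
    UnboundedOperators.heatExtension_apply]
  refine integral_congr_ae (Eventually.of_forall fun y => ?_)
  simp only [hΦ, heatFlow_of_pos _ hσ]

/-- The `L¹` norms of the commutator force are bounded on `[s₀, t₁]`. [folklore] -/
theorem exists_forall_integral_norm_locForce_le :
    ∃ A : ℝ, 0 ≤ A ∧ ∀ s ∈ Icc s₀ t₁, ∫ x, ‖locForce χ u p s x‖ ≤ A := by
  obtain ⟨C, hC0, hC⟩ := exists_forall_norm_locForce_le hsol hχ hI
  set K : Set (EuclideanSpace ℝ (Fin 3)) := closedBall x₁ (R - 3) with hK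
  have hKvol : volume K < (⊤ : ℝ≥0∞) := (isCompact_closedBall x₁ (R - 3)).measure_lt_top
  refine ⟨C * (volume K).toReal, by positivity, fun s hs => ?_⟩
  have h0 : ∀ x ∉ K, ‖locForce χ u p s x‖ = 0 := fun x hx => by
    rw [image_eq_zero_of_notMem_tsupport fun h => hx (tsupport_locForce_subset hχ h), norm_zero]
  rw [← setIntegral_eq_integral_of_forall_compl_eq_zero h0]
  calc ∫ x in K, ‖locForce χ u p s x‖ ≤ ∫ _ in K, C := by
        refine setIntegral_mono_on ?_ (integrableOn_const hKvol.ne) measurableSet_closedBall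
          fun x _ => hC s hs x
        exact ((contDiff_locForce hsol hχ (hI hs)).continuous.norm).continuousOn.integrableOn_compact
          (isCompact_closedBall _ _)
    _ = C * (volume K).toReal := by rw [setIntegral_const, smul_eq_mul, mul_comm]; rfl

/-- **Heat-kernel smoothing of the commutator force**: `‖e^{σΔ}f₀(s)(x)‖ ≤ (4πσ)^{-3/2} ‖f₀(s)‖₁`.
[folklore] -/
theorem norm_heatExtension_locForce_le {s : ℝ} (hs : s ∈ Icc s₀ t₁) {σ : ℝ} (hσ : 0 < σ)
    (x : EuclideanSpace ℝ (Fin 3)) :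
    ‖UnboundedOperators.heatExtension (locForce χ u p s) σ x‖ ≤
      (4 * Real.pi * σ) ^ (-(3 : ℝ) / 2) * ∫ y, ‖locForce χ u p s y‖ := by
  have hf : Continuous (locForce χ u p s) := (contDiff_locForce hsol hχ (hI hs)).continuous
  have hfc := hasCompactSupport_locForce hχ (u := u) (p := p) (t := s)
  have hfi : Integrable (fun y => ‖locForce χ u p s (x - y)‖) :=
    ((hf.integrable_of_hasCompactSupport hfc).comp_sub_left x).norm
  rw [UnboundedOperators.heatExtension_apply, ← integral_sub_left_eq_self (fun y => ‖locForce χ u p s y‖)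
    volume x, ← integral_const_mul]
  refine (norm_integral_le_integral_norm _).trans (integral_mono_of_nonneg
    (Eventually.of_forall fun y => norm_nonneg _) (hfi.const_mul _) (Eventually.of_forall fun y => ?_))
  show ‖UnboundedOperators.heatKernel σ y • locForce χ u p s (x - y)‖ ≤
    (4 * Real.pi * σ) ^ (-(3 : ℝ) / 2) * ‖locForce χ u p s (x - y)‖
  rw [norm_smul, Real.norm_of_nonneg (UnboundedOperators.heatKernel_pos hσ y).le]
  refine mul_le_mul_of_nonneg_right ?_ (norm_nonneg _)
  have h := UnboundedOperators.heatKernel_le hσ y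
  rwa [finrank_euclideanSpace_fin, show (-((3 : ℕ) : ℝ)) / 2 = -(3 : ℝ) / 2 by norm_num] at h

/-- **The heat flow of the forcing term vanishes at infinity**: there is `C'` with
`‖e^{θΔ}F(t)(x)‖ ≤ C' (t - s₀) θ^{-1/2}` for all `t ∈ [s₀, t₁]`, `θ ≥ 1`, `x`
(`e^{σΔ}P[f₀] = e^{σΔ}f₀ - ∇e^{σΔ}π[f₀]`, `σ = t - s + θ ≥ θ ≥ 1`). [cite: LemarieRieusset2016, Def. 6.5 with Thm. 6.1] -/
theorem exists_norm_heatExtension_locForcing_le :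
    ∃ C' : ℝ, 0 ≤ C' ∧ ∀ t ∈ Icc s₀ t₁, ∀ ⦃θ : ℝ⦄, 1 ≤ θ → ∀ x,
      ‖UnboundedOperators.heatExtension (locForcing χ u p s₀ t) θ x‖ ≤ C' * (t - s₀) * θ ^ (-(1 / 2 : ℝ)) := by
  obtain ⟨A, hA0, hA⟩ := exists_forall_integral_norm_locForce_le hsol hχ hI
  obtain ⟨Cπ', hCπ'⟩ := exists_forall_abs_divPotential_locForce_le hsol hχ hI
  obtain ⟨C₁, hC₁0, hC₁⟩ := exists_forall_norm_locForce_le hsol hχ hI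
  obtain ⟨C₂, hC₂0, hC₂⟩ := exists_forall_norm_gradient_divPotential_locForce_le hsol hχ hI
  set Cπ : ℝ := max Cπ' 0 with hCπdef
  have hCπ0 : 0 ≤ Cπ := le_max_right _ _
  have hCπ : ∀ s ∈ Icc s₀ t₁, ∀ y, |divPotential (locForce χ u p s) y| ≤ Cπ := fun s hs y =>
    (hCπ' s hs y).trans (le_max_left _ _)
  set D : ℝ := (2 : ℝ) ^ ((Module.finrank ℝ (EuclideanSpace ℝ (Fin 3)) : ℝ) / 2) with hD
  refine ⟨A + D * Cπ, by positivity, fun t ht θ hθ x => ?_⟩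
  have hθ0 : 0 < θ := by linarith
  rw [heatExtension_locForcing_apply hsol hχ hI ht hθ0 x]
  have hpt : ∀ s ∈ Ioo s₀ t, ‖UnboundedOperators.heatExtension (locProjForce χ u p s) (t - s + θ) x‖ ≤
      (A + D * Cπ) * θ ^ (-(1 / 2 : ℝ)) := by
    intro s hs
    have hsI : s ∈ Icc s₀ t₁ := ⟨hs.1.le, hs.2.le.trans ht.2⟩
    set σ : ℝ := t - s + θ with hσdef
    have hσθ : θ ≤ σ := by rw [hσdef]; linarith [hs.2]
    have hσ1 : 1 ≤ σ := hθ.trans hσθ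
    have hσ0 : 0 < σ := by linarith
    -- splitting `P[f₀] = f₀ - ∇π`
    have hf : Continuous (locForce χ u p s) := (contDiff_locForce hsol hχ (hI hsI)).continuous
    have hπ1 : ContDiff ℝ 1 (divPotential (locForce χ u p s)) :=
      (contDiff_divPotential (contDiff_locForce hsol hχ (hI hsI)) (hasCompactSupport_locForce hχ)).of_le
        (by norm_cast)
    have hg : Continuous (gradient (divPotential (locForce χ u p s))) := continuous_gradient_of_contDiff hπ1
    have hsplit : UnboundedOperators.heatExtension (locProjForce χ u p s) σ x =
        UnboundedOperators.heatExtension (locForce χ u p s) σ x -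
          UnboundedOperators.heatExtension (gradient (divPotential (locForce χ u p s))) σ x := by
      rw [show locProjForce χ u p s = fun z => locForce χ u p s z -
        gradient (divPotential (locForce χ u p s)) z from rfl]
      exact UnboundedOperators.heatExtension_sub_of_bound hf hg (hC₁ s hsI) (hC₂ s hsI) hσ0 x
    -- term 1
    have h1 : ‖UnboundedOperators.heatExtension (locForce χ u p s) σ x‖ ≤ A * θ ^ (-(1 / 2 : ℝ)) := by
      refine (norm_heatExtension_locForce_le hsol hχ hI hsI hσ0 x).trans ?_
      have hk : (4 * Real.pi * σ) ^ (-(3 : ℝ) / 2) ≤ θ ^ (-(1 / 2 : ℝ)) := by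
        have e : (4 * Real.pi * σ) ^ (-(3 : ℝ) / 2) = (4 * Real.pi) ^ (-(3 : ℝ) / 2) * σ ^ (-(3 : ℝ) / 2) :=
          Real.mul_rpow (by positivity) hσ0.le
        rw [e]
        have hπ4 : (4 * Real.pi) ^ (-(3 : ℝ) / 2) ≤ 1 :=
          Real.rpow_le_one_of_one_le_of_nonpos (by linarith [Real.pi_gt_three]) (by norm_num)
        have hs2 : σ ^ (-(3 : ℝ) / 2) ≤ σ ^ (-(1 / 2 : ℝ)) :=
          Real.rpow_le_rpow_of_exponent_le hσ1 (by norm_num)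
        have hs3 : σ ^ (-(1 / 2 : ℝ)) ≤ θ ^ (-(1 / 2 : ℝ)) :=
          Real.rpow_le_rpow_of_nonpos hθ0 hσθ (by norm_num)
        calc (4 * Real.pi) ^ (-(3 : ℝ) / 2) * σ ^ (-(3 : ℝ) / 2) ≤ 1 * σ ^ (-(1 / 2 : ℝ)) := by
              gcongr
          _ ≤ θ ^ (-(1 / 2 : ℝ)) := by rw [one_mul]; exact hs3
      calc (4 * Real.pi * σ) ^ (-(3 : ℝ) / 2) * ∫ y, ‖locForce χ u p s y‖
          ≤ θ ^ (-(1 / 2 : ℝ)) * A :=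
            mul_le_mul hk (hA s hsI) (integral_nonneg fun _ => norm_nonneg _) (by positivity)
        _ = A * θ ^ (-(1 / 2 : ℝ)) := mul_comm _ _
    -- term 2
    have h2 : ‖UnboundedOperators.heatExtension (gradient (divPotential (locForce χ u p s))) σ x‖ ≤
        D * Cπ * θ ^ (-(1 / 2 : ℝ)) := by
      rw [heatExtension_gradient_divPotential (contDiff_locForce hsol hχ (hI hsI))
        (hasCompactSupport_locForce hχ) hσ0 x, gradient, LinearIsometryEquiv.norm_map]
      have hb := UnboundedOperators.norm_fderiv_heatExtension_le_of_bounded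
        (f := divPotential (locForce χ u p s)) hπ1.continuous.aestronglyMeasurable
        (fun z => (Real.norm_eq_abs _).le.trans (hCπ s hsI z)) hσ0 x
      refine hb.trans ?_
      rw [← hD]
      have hs3 : σ ^ (-(1 / 2 : ℝ)) ≤ θ ^ (-(1 / 2 : ℝ)) :=
        Real.rpow_le_rpow_of_nonpos hθ0 hσθ (by norm_num)
      calc D * σ ^ (-(1 / 2 : ℝ)) * Cπ = D * Cπ * σ ^ (-(1 / 2 : ℝ)) := by ring
        _ ≤ D * Cπ * θ ^ (-(1 / 2 : ℝ)) := by gcongr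
    rw [hsplit]
    calc ‖_ - _‖ ≤ ‖UnboundedOperators.heatExtension (locForce χ u p s) σ x‖ +
          ‖UnboundedOperators.heatExtension (gradient (divPotential (locForce χ u p s))) σ x‖ :=
          norm_sub_le _ _
      _ ≤ A * θ ^ (-(1 / 2 : ℝ)) + D * Cπ * θ ^ (-(1 / 2 : ℝ)) := add_le_add h1 h2
      _ = (A + D * Cπ) * θ ^ (-(1 / 2 : ℝ)) := by ring
  have h := norm_setIntegral_le_of_norm_le_const (μ := (volume : Measure ℝ)) measure_Ioo_lt_top hpt
  rw [Measure.real, Real.volume_Ioo, ENNReal.toReal_ofReal (by linarith [ht.1])] at h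
  calc _ ≤ (A + D * Cπ) * θ ^ (-(1 / 2 : ℝ)) * (t - s₀) := h
    _ = (A + D * Cπ) * (t - s₀) * θ ^ (-(1 / 2 : ℝ)) := by ring

end HeatFlowAtInfinity

end BGK2015

end Literature.Analysis.FluidPDE
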